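import Literature.NumberTheory.EllipticCurves.Wuthrich2014.ThreeAdicImageOrdinaryProofs
import Literature.NumberTheory.EllipticCurves.Rank1Residual.Typed.X10
import Literature.NumberTheory.EllipticCurves.Rank1Residual.Typed.PAdicCertificateGoodOrdinary
import HarnessLib

/-!
# Class X10 without the Lemma-20 binder: the `3`-adic tower on `GoodOrd W 3 ∧ Surj W 3` is a theorem

HONEST FRAMING (cell `b2b-bsdres`, home `run/shared/lean/b2b/bsd-rank1-residual/`): the cell deletes
COMBINATION-SHAPED residual classes of the rank-`≤ 1` BSD formula from PUBLISHED theorems only and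
types the construction-shaped remainder; announced results are OPEN hypotheses; this is not
"finishing BSD".  `Proofs` file (theorems only: no definition, no named fact, debt 0), unit
`b2b-bsdres-lit-kato` gen 7 (off-peak Kato-2004 typer).

Every `p = 3` consumer of Kato's integral divisibility (Thm. 17.4 (3) under (12.5.2)) on class X10
(`3` good ordinary, `E[3]` irreducible; `Rank1Residual/X10Proofs.lean`, `Typed/X10.lean`,
`X10MainConjecture.lean`, `Typed/PAdicCertificateGoodOrdinary.lean`) carried the named fact
`Wuthrich2014.lemma20_surjective_threeAdic_of_semistable` (registry A9) as the binder `hW20`, used only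
through `hW20 W (Or.inl <good at 3>) hsurj`.  On that locus the lemma is now the tree THEOREM
`WeierstrassCurve.forall_hasSurjectiveModNGaloisRep_pow_of_goodOrdinary_of_surj`
(`Wuthrich2014/ThreeAdicImageOrdinaryProofs.lean`: Serre–Tate filtration + `χ_p(I_p) = ℤ_pˣ` + the
first-order witness `σ₄σ₋σ₄σ₋`), so the binder can be dropped.  This file records the `hW20`-free forms
of the class statements (one-line re-derivations; the originals are untouched):

* `surjective_pow_of_goodOrd_of_surj` — `GoodOrd W p → Surj W p → ∀ n, surj(p^n)` (`p` odd), and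
  `X10.towerSurj_of_surj` — `ClassX10 W 3 → Surj W 3 → ∀ n, surj(3^n)` (cf.
  `X10.surjective_pow_three_of_surj`, which takes `hW20`); `X10.imageContainsSL2_of_surj` — Kato's
  (12.5.2) on X10a′;
* `X10.bsdp_of_surj` — `ClassX10 W 3 → Surj W 3 → BSDp W 3` from Yan–Zhu 2026 Thm. 4.15 (PUB\*,
  flags `YZ26-BF-equiv`, `YZ26@3-BF-ERL-Ohta` unchanged), GZK, modularity — and NO Lemma 20
  (cf. `bsdp_of_classX10_of_surj`); `X10.dichotomy_of_surj_bit`, `Typed.X10.bsdp_three_of_missingInputAt_of_tower`,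
  `Typed.X10.accounted_of_tower` — the `hW20`-free forms of `classX10_dichotomy`,
  `X10.bsdp_three_of_missingInputAt`, `X10.accounted`;
* `Typed.bsdp_of_kato_of_surj_of_leadingTerm_certificate_of_tower` — the per-curve `p`-adic BSD
  certificate route at EVERY odd good ordinary `p` with `Surj W p` (cf.
  `bsdp_of_kato_of_surj_of_leadingTerm_certificate`, which split `p ≥ 5` (Serre) / `p = 3` (Lemma 20));
  `Typed.X10.bsdp_three_of_kato_of_leadingTerm_certificate_of_tower` — its X10 instance.

Nothing is booked and no label changes: X10a′ stays PUB\* (Yan–Zhu), X10b stays typed; what changes is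
that the X10a′ closure `ClassX10 W 3 → Surj W 3 → BSDp W 3` now rests on Yan–Zhu + GZK + modularity
ALONE (three named facts instead of four).

## References

* [Wuthrich2014] C. Wuthrich, Doc. Math. 19 (2014), Lemma 20 (p. 399).
* [YanZhu2024MainConjNonCM] X. Yan, X. Zhu, Thm. 4.15 (§4.6).
* [Kato2004Asterisque] K. Kato, Astérisque 295 (2004), (12.5.2) (p. 222), Thm. 17.4 (3) (p. 273).
* [Greenberg1991] R. Greenberg, LMS LNS 153 (1991), §2.
-/

noncomputable section

open scoped Classical NumberField MatrixGroups ModularForm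

open CongruenceSubgroup WeierstrassCurve Literature.NumberTheory.EllipticCurves
  Literature.NumberTheory.EllipticCurves.ModularForms
  Literature.NumberTheory.EllipticCurves.Wuthrich2014

namespace Literature.NumberTheory.EllipticCurves.Rank1Residual

variable {W : WeierstrassCurve ℚ} [W.IsElliptic] [W.IsGloballyMinimal] {p : ℕ} [Fact p.Prime]

variable (W) in
/-- **`GoodOrd W p ∧ Surj W p ⟹ ρ̄_{E,p^n}` onto for all `n`** (`p` odd) — THEOREM (no Lemma-20 /
Serre binder): `WeierstrassCurve.forall_hasSurjectiveModNGaloisRep_pow_of_goodOrdinary_of_surj` in the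
predicate vocabulary of `Rank1Residual/Predicates.lean`. [cite: Wuthrich2014, Lemma 20 (p. 399)]
[cite: Greenberg1991, §2 (p. 214)] -/
theorem surjective_pow_of_goodOrd_of_surj (hp2 : p ≠ 2) (hord : GoodOrd W p) (hsurj : Surj W p) :
    ∀ n : ℕ, W.HasSurjectiveModNGaloisRep (p ^ n : ℕ) :=
  W.forall_hasSurjectiveModNGaloisRep_pow_of_goodOrdinary_of_surj p hp2 hord.1 hord.2 hsurj

variable (W) in
/-- **On X10 with `surj(3)`, `ρ̄_{E,3^n}` is onto for every `n` — unconditionally** (cf.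
`X10.surjective_pow_three_of_surj`, the same statement under the named fact `hW20`).
[cite: Wuthrich2014, Lemma 20 (p. 399)] -/
theorem X10.towerSurj_of_surj (hX : ClassX10 W 3) (hsurj : Surj W 3) :
    ∀ n : ℕ, W.HasSurjectiveModNGaloisRep (3 ^ n : ℕ) :=
  surjective_pow_of_goodOrd_of_surj W (by decide) hX.2.1 hsurj

variable (W) in
/-- **Kato's (12.5.2) holds on X10a′** (`ClassX10 W 3 ∧ Surj W 3`): the hypothesis of the integral
clause Kato 2004 Thm. 17.4 (3) at `p = 3` is a theorem on the surjective part of class X10.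
[cite: Kato2004Asterisque, (12.5.2) in Thm. 12.5 (4) (p. 222); Thm. 17.4 (3) (p. 273)] -/
theorem X10.imageContainsSL2_of_surj (hX : ClassX10 W 3) (hsurj : Surj W 3) :
    Kato2004.ImageContainsSL2 W 3 :=
  Kato2004.imageContainsSL2_of_goodOrdinary_of_surj W 3 (by decide) hX.2.1.1 hX.2.1.2 hsurj

/-- **X10 ∩ surj(3): `ClassX10 W 3 → Surj W 3 → BSDp W 3` from Yan–Zhu 2026 Thm. 4.15 (`hYZ`,
PUB\*, flags `YZ26-BF-equiv` / `YZ26@3-BF-ERL-Ohta` as in `bsdp_of_classX10_of_surj`), Gross–Zagier–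
Kolyvagin (`hGZK`) and modularity (`hmod`) — WITHOUT the Wuthrich-Lemma-20 binder**, the `3`-adic
surjectivity being `X10.towerSurj_of_surj`. [cite: YanZhu2024MainConjNonCM, Thm. 4.15 (§4.6)]
[cite: Wuthrich2014, Lemma 20 (p. 399)] -/
theorem X10.bsdp_of_surj
    (hYZ : YanZhu2026.thm415_padicValRat_bsd_rank_le_one)
    (hGZK : rank_eq_analyticRank_of_analyticRank_le_one) (hmod : hasEntireLFunction_rat)
    (hX : ClassX10 W 3) (hsurj : Surj W 3) : BSDp W 3 :=
  bsdp_of_classX10_of_padicSurjective hYZ hGZK hmod hX (X10.towerSurj_of_surj W hX hsurj)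

/-- **The X10 dichotomy on the census bit `surj(3)`, Lemma-20-free** (cf. `classX10_dichotomy`):
`surj(3)` ⇒ `BSD(E,3)` (Yan–Zhu, GZK, modularity); `¬surj(3)` ⇒ (Im) fails (x9 seat's
`ClassX10.not_bigIm_of_not_surj`, unconditional). [cite: YanZhu2024MainConjNonCM, Thm. 4.15 (§4.6)] -/
theorem X10.dichotomy_of_surj_bit
    (hYZ : YanZhu2026.thm415_padicValRat_bsd_rank_le_one)
    (hGZK : rank_eq_analyticRank_of_analyticRank_le_one) (hmod : hasEntireLFunction_rat)
    (hX : ClassX10 W 3) : (Surj W 3 → BSDp W 3) ∧ (¬ Surj W 3 → ¬ BigIm W 3) :=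
  ⟨X10.bsdp_of_surj hYZ hGZK hmod hX, ClassX10.not_bigIm_of_not_surj W 3 hX⟩

end Literature.NumberTheory.EllipticCurves.Rank1Residual

namespace Literature.NumberTheory.EllipticCurves.Rank1Residual.Typed

open Literature.NumberTheory.EllipticCurves.Rank1Residual

/-- **X10 conditional class theorem at `p = 3`, Lemma-20-free** (cf. `X10.bsdp_three_of_missingInputAt`):
on `surj(3)` from Yan–Zhu / GZK / modularity, on `¬surj(3)` from the typed missing input.
[cite: YanZhu2024MainConjNonCM, Thm. 4.15 (§4.6)] [cite: Miller2011LMS, §1 and Def. 1.1] -/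
theorem X10.bsdp_three_of_missingInputAt_of_tower
    (hYZ : YanZhu2026.thm415_padicValRat_bsd_rank_le_one)
    (hGZK : rank_eq_analyticRank_of_analyticRank_le_one) (hmod : hasEntireLFunction_rat)
    (W : WeierstrassCurve ℚ) [W.IsElliptic] [W.IsGloballyMinimal]
    (hX : ClassX10 W 3) (hmiss : X10.MissingInputAt W) : BSDp W 3 := by
  by_cases hs : Surj W 3
  · exact Rank1Residual.X10.bsdp_of_surj hYZ hGZK hmod hX hs
  · exact bsdp_of_missingPPartAt W 3 hGZK hX.analyticRank_le_one (hmiss hs)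

/-- **The X10 trichotomy of evidence, Lemma-20-free** (cf. `X10.accounted`): `surj(3)` ⇒ `BSD(E,3)`;
`¬surj(3)` ⇒ (Im) fails AND `BSD(E,3)` ⟺ the typed missing input (`Ш` finite by GZK).
[cite: YanZhu2024MainConjNonCM, Thm. 4.15 (§4.6), hypothesis (Im)] [cite: Miller2011LMS, Def. 1.1] -/
theorem X10.accounted_of_tower
    (hYZ : YanZhu2026.thm415_padicValRat_bsd_rank_le_one)
    (hGZK : rank_eq_analyticRank_of_analyticRank_le_one) (hmod : hasEntireLFunction_rat)
    (W : WeierstrassCurve ℚ) [W.IsElliptic] [W.IsGloballyMinimal] (hX : ClassX10 W 3) :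
    (Surj W 3 → BSDp W 3) ∧
      (¬ Surj W 3 → ¬ BigIm W 3 ∧ (MissingPPartAt W 3 ↔ BSDp W 3)) := by
  refine ⟨fun hs => Rank1Residual.X10.bsdp_of_surj hYZ hGZK hmod hX hs, fun hns => ⟨?_, ?_⟩⟩
  · exact ClassX10.not_bigIm_of_not_surj W 3 hX hns
  · haveI : Finite W.sha := (hGZK W hX.analyticRank_le_one).2
    exact ⟨fun h => bsdp_of_missingPPartAt W 3 hGZK hX.analyticRank_le_one h,
      fun h => missingPPartAt_of_bsdp W 3 h⟩

/-- **The census form of the `p`-adic BSD certificate route at EVERY odd good ordinary prime with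
`Surj W p` — Lemma-20-free and without the `p ≥ 5` / `p = 3` case split** (cf.
`bsdp_of_kato_of_surj_of_leadingTerm_certificate`): the tower `∀ n, surj(p^n)` needed by Kato
Thm. 17.4 (3) is `surjective_pow_of_goodOrd_of_surj`. Per curve; NOT a class theorem.
[cite: Kato2004Asterisque, Thm. 17.4 (3) (p. 273)] [cite: BalakrishnanMullerStein2015, Thm. 1.7]
[cite: Wuthrich2014, Lemma 20 (p. 399)] -/
theorem bsdp_of_kato_of_surj_of_leadingTerm_certificate_of_tower
    (hS : Schneider1985_order_charGenerator_odd)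
    (hGZK : rank_eq_analyticRank_of_analyticRank_le_one)
    (W : WeierstrassCurve ℚ) [W.IsElliptic] [W.IsGloballyMinimal] (p : ℕ) [Fact p.Prime]
    {N : ℕ} [NeZero N] (f : CuspForm (Gamma0 N) 2)
    (hK : ∀ (κ : ZpExtension ℚ p) (γ : Field.absoluteGaloisGroup ℚ),
      kato_divisibility W p (κ := κ) (γ := γ) (f := f))
    (hp : p ≠ 2) (hgood : W.HasGoodReductionAtPrime p) (hordp : ¬ (p : ℤ) ∣ W.frobeniusTrace p)
    (hsurj : Surj W p) (hf : IsNewformOf W f)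
    (Dh : PAdicHeightData W p) (hDh : Dh.IsCanonical) (hr : W.analyticRank ≤ 1)
    (hord : (padicLFunction f (unitRoot W p : ℚ_[p])).order = W.analyticRank)
    (hcert : (PowerSeries.coeff W.analyticRank (padicLFunction f (unitRoot W p : ℚ_[p])) *
          (padicLog p (cyclotomicGenerator p) ^ W.analyticRank *
            (W.torsionOrder : ℚ_[p]) ^ 2)).valuation =
        ((1 - (unitRoot W p : ℚ_[p])⁻¹) ^ 2 * (W.tamagawaProduct : ℚ_[p]) *
          padicRegulator Dh).valuation)
    {s : ℚ} (hs : shaAn W = (s : ℂ)) (hv : padicValRat p s = 0) : BSDp W p :=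
  bsdp_of_kato_of_leadingTerm_certificate hS hGZK W p f hK hp hgood hordp
    (surjective_pow_of_goodOrd_of_surj W hp ⟨hgood, hordp⟩ hsurj) hf Dh hDh hr hord hcert hs hv

/-- **X10 ∩ surj(3), per curve, WITHOUT Yan–Zhu and WITHOUT Lemma 20** (cf.
`X10.bsdp_three_of_kato_of_leadingTerm_certificate`): Kato Thm. 17.4 (`hK`), Perrin-Riou–Schneider /
BMS Thm. 1.7 (`hS`), GZK (`hGZK`) + the per-curve `3`-adic certificate + `3 ∤ #Ш_an`. Per curve;
NOT a class theorem. [cite: Kato2004Asterisque, Thm. 17.4 (3) (p. 273)]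
[cite: BalakrishnanMullerStein2015, Thm. 1.7] -/
theorem X10.bsdp_three_of_kato_of_leadingTerm_certificate_of_tower
    (hS : Schneider1985_order_charGenerator_odd)
    (hGZK : rank_eq_analyticRank_of_analyticRank_le_one)
    (W : WeierstrassCurve ℚ) [W.IsElliptic] [W.IsGloballyMinimal]
    {N : ℕ} [NeZero N] (f : CuspForm (Gamma0 N) 2)
    (hK : ∀ (κ : ZpExtension ℚ 3) (γ : Field.absoluteGaloisGroup ℚ),
      kato_divisibility W 3 (κ := κ) (γ := γ) (f := f))
    (hX : ClassX10 W 3) (hsurj : Surj W 3) (hf : IsNewformOf W f)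
    (Dh : PAdicHeightData W 3) (hDh : Dh.IsCanonical)
    (hord : (padicLFunction f (unitRoot W 3 : ℚ_[3])).order = W.analyticRank)
    (hcert : (PowerSeries.coeff W.analyticRank (padicLFunction f (unitRoot W 3 : ℚ_[3])) *
          (padicLog 3 (cyclotomicGenerator 3) ^ W.analyticRank *
            (W.torsionOrder : ℚ_[3]) ^ 2)).valuation =
        ((1 - (unitRoot W 3 : ℚ_[3])⁻¹) ^ 2 * (W.tamagawaProduct : ℚ_[3]) *
          padicRegulator Dh).valuation)
    {s : ℚ} (hs : shaAn W = (s : ℂ)) (hv : padicValRat 3 s = 0) : BSDp W 3 :=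
  bsdp_of_kato_of_surj_of_leadingTerm_certificate_of_tower hS hGZK W 3 f hK (by decide) hX.2.1.1
    hX.2.1.2 hsurj hf Dh hDh hX.analyticRank_le_one hord hcert hs hv

end Literature.NumberTheory.EllipticCurves.Rank1Residual.Typed

end
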